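import Literature.Analysis.PDE.WeakHarnackBarrier
import Mathlib.Analysis.Calculus.FDeriv.Symmetric
import Mathlib.Analysis.SpecialFunctions.Log.Basic
import HarnessLib

/-!
# Regularity of the Krylov–Safonov barrier on the unit ball (for the ABP estimate)

For `u` of class `C²` on an open `U ⊇ B̄₁` with `u ≥ 0` on `B̄₁` and `N > 0`, the barrier
`v = η_m · (-log(u+N))` of `WeakHarnackBarrier` has all the regularity the ABP estimate
(`Literature.Analysis.PDE.ABP.addHaar_ball_le_lintegral_elliptic`) asks for on
`Ω' = {v > 0} ∩ B₁`: continuity on `B̄₁`, differentiability and twice-differentiability in `B₁`,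
continuity of the gradient in `B₁`, symmetry of `D²v`, and `v = 0` on `∂B₁`.

## References

* D. Gilbarg, N. S. Trudinger, *Elliptic Partial Differential Equations of Second Order* (2001),
  proof of Theorem 9.22. [GilbargTrudinger2001]
-/

noncomputable section

open Set InnerProductSpace RealInnerProductSpace Matrix Filter Metric
open scoped Topology

namespace Literature.Analysis.PDE.KrylovSafonov

open Literature.Analysis.PDE.ABP

variable {E : Type*} [NormedAddCommGroup E] [InnerProductSpace ℝ E]

omit [InnerProductSpace ℝ E] in
/-- `η` is continuous. [folklore] -/
theorem continuous_eta (m : ℕ) : Continuous (eta (E := E) m) := by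
  unfold eta; fun_prop

omit [InnerProductSpace ℝ E] in
/-- `η > 0` in the open unit ball. [folklore] -/
theorem eta_pos {m : ℕ} {y : E} (hy : ‖y‖ < 1) : 0 < eta m y := by
  rw [eta]; exact pow_pos (by nlinarith [norm_nonneg y]) _

omit [InnerProductSpace ℝ E] in
/-- `η = 0` on the unit sphere. [folklore] -/
theorem eta_eq_zero {m : ℕ} {y : E} (hy : ‖y‖ = 1) : eta m y = 0 := by
  rw [eta, hy]; simp

omit [InnerProductSpace ℝ E] in
/-- `η ≤ 1` on the closed unit ball. [folklore] -/
theorem eta_le_one {m : ℕ} {y : E} (hy : ‖y‖ ≤ 1) : eta m y ≤ 1 := by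
  rw [eta]
  exact pow_le_one₀ (by nlinarith [norm_nonneg y]) (by nlinarith [norm_nonneg y])

omit [InnerProductSpace ℝ E] in
/-- `η ≥ (1 - ρ²)^{m+2}` on `B̄_ρ`. [folklore] -/
theorem eta_ge {m : ℕ} {ρ : ℝ} {y : E} (hρ : ρ < 1) (hy : ‖y‖ ≤ ρ) (hρ0 : 0 ≤ ρ) :
    (1 - ρ ^ 2) ^ (m + 2) ≤ eta m y := by
  rw [eta]
  exact pow_le_pow_left₀ (by nlinarith) (by nlinarith [norm_nonneg y]) _

section Regularity

variable {U : Set E} {u : E → ℝ} {N : ℝ} {m : ℕ}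

omit [InnerProductSpace ℝ E] in
/-- **Continuity of the barrier on `B̄₁`.** [folklore] -/
theorem continuousOn_barrier (hu : ContinuousOn u (closedBall (0 : E) 1))
    (hpos : ∀ y ∈ closedBall (0 : E) 1, 0 < u y + N) :
    ContinuousOn (barrier m u N) (closedBall (0 : E) 1) := by
  refine (continuous_eta m).continuousOn.mul ((hu.add continuousOn_const).log ?_).neg
  exact fun y hy ↦ (hpos y hy).ne'

/-- The eventual hypothesis of the calculus files at an interior point. [folklore] -/
theorem eventually_differentiableAt_pos (hU : IsOpen U) (hBU : closedBall (0 : E) 1 ⊆ U)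
    (hu : ContDiffOn ℝ 2 u U) (hpos : ∀ y ∈ closedBall (0 : E) 1, 0 < u y + N)
    (hcont : ContinuousOn u U) {y : E} (hy : ‖y‖ < 1) :
    ∀ᶠ z in 𝓝 y, DifferentiableAt ℝ u z ∧ 0 < u z + N := by
  have hyU : y ∈ U := hBU (mem_closedBall_zero_iff.2 hy.le)
  have hd : ∀ᶠ z in 𝓝 y, DifferentiableAt ℝ u z := by
    filter_upwards [hU.mem_nhds hyU] with z hz
    exact (hu.differentiableOn (by norm_num)).differentiableAt (hU.mem_nhds hz)
  have hp : ∀ᶠ z in 𝓝 y, 0 < u z + N := by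
    have hc : ContinuousAt (fun z ↦ u z + N) y :=
      ((hcont.continuousAt (hU.mem_nhds hyU)).add continuousAt_const)
    exact hc.eventually (lt_mem_nhds (hpos y (mem_closedBall_zero_iff.2 hy.le)))
  exact hd.and hp

/-- `D(u)` is differentiable at interior points. [folklore] -/
theorem differentiableAt_fderiv_of_contDiffOn (hU : IsOpen U) (hu : ContDiffOn ℝ 2 u U) {y : E}
    (hyU : y ∈ U) : DifferentiableAt ℝ (fderiv ℝ u) y :=
  ((hu.fderiv_of_isOpen hU (m := 1) (by norm_num)).differentiableOn one_ne_zero).differentiableAt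
    (hU.mem_nhds hyU)

/-- **The barrier is twice differentiable in `B₁`.** [folklore] -/
theorem differentiableAt_fderiv_barrier (hU : IsOpen U) (hBU : closedBall (0 : E) 1 ⊆ U)
    (hu : ContDiffOn ℝ 2 u U) (hpos : ∀ y ∈ closedBall (0 : E) 1, 0 < u y + N) {y : E}
    (hy : ‖y‖ < 1) : DifferentiableAt ℝ (fderiv ℝ (barrier m u N)) y := by
  have hev := eventually_differentiableAt_pos hU hBU hu hpos hu.continuousOn hy
  have hφev : ∀ᶠ z in 𝓝 y, DifferentiableAt ℝ (fun z ↦ u z + N) z ∧ 0 < u z + N := by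
    filter_upwards [hev] with z hz; exact ⟨hz.1.add_const N, hz.2⟩
  have hyU : y ∈ U := hBU (mem_closedBall_zero_iff.2 hy.le)
  have hφ2 : DifferentiableAt ℝ (fderiv ℝ (fun z ↦ u z + N)) y := by
    rw [fderiv_add_const_fun]; exact differentiableAt_fderiv_of_contDiffOn hU hu hyU
  have hηw : ∀ᶠ z in 𝓝 y, DifferentiableAt ℝ (eta m) z ∧
      DifferentiableAt ℝ (fun z ↦ -Real.log (u z + N)) z := by
    filter_upwards [hφev] with z hz
    exact ⟨differentiableAt_eta m z, (hasFDerivAt_negLog hz.1 hz.2).differentiableAt⟩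
  exact differentiableAt_fderiv_mul hηw (differentiableAt_fderiv_eta m y)
    (differentiableAt_fderiv_negLog hφev hφ2)

/-- **The barrier is differentiable in `B₁`.** [folklore] -/
theorem differentiableAt_barrier (hU : IsOpen U) (hBU : closedBall (0 : E) 1 ⊆ U)
    (hu : ContDiffOn ℝ 2 u U) (hpos : ∀ y ∈ closedBall (0 : E) 1, 0 < u y + N) {y : E}
    (hy : ‖y‖ < 1) : DifferentiableAt ℝ (barrier m u N) y := by
  have hev := (eventually_differentiableAt_pos hU hBU hu hpos hu.continuousOn hy).self_of_nhds
  exact (differentiableAt_eta m y).mul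
    (hasFDerivAt_negLog (hev.1.add_const N) hev.2).differentiableAt

/-- **Symmetry of `D²v` in `B₁`.** [folklore] -/
theorem fderiv_fderiv_barrier_symm (hU : IsOpen U) (hBU : closedBall (0 : E) 1 ⊆ U)
    (hu : ContDiffOn ℝ 2 u U) (hpos : ∀ y ∈ closedBall (0 : E) 1, 0 < u y + N) {y : E}
    (hy : ‖y‖ < 1) (v w : E) :
    fderiv ℝ (fderiv ℝ (barrier m u N)) y v w = fderiv ℝ (fderiv ℝ (barrier m u N)) y w v := by
  have hev := eventually_differentiableAt_pos hU hBU hu hpos hu.continuousOn hy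
  have hφev : ∀ᶠ z in 𝓝 y, DifferentiableAt ℝ (fun z ↦ u z + N) z ∧ 0 < u z + N := by
    filter_upwards [hev] with z hz; exact ⟨hz.1.add_const N, hz.2⟩
  have hyU : y ∈ U := hBU (mem_closedBall_zero_iff.2 hy.le)
  have hφ2 : DifferentiableAt ℝ (fderiv ℝ (fun z ↦ u z + N)) y := by
    rw [fderiv_add_const_fun]; exact differentiableAt_fderiv_of_contDiffOn hU hu hyU
  have hηw : ∀ᶠ z in 𝓝 y, DifferentiableAt ℝ (eta m) z ∧
      DifferentiableAt ℝ (fun z ↦ -Real.log (u z + N)) z := by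
    filter_upwards [hφev] with z hz
    exact ⟨differentiableAt_eta m z, (hasFDerivAt_negLog hz.1 hz.2).differentiableAt⟩
  -- symmetry of `D²u` (hence of `D²(u+N)`) from `C²`
  have husymm : ∀ v w, fderiv ℝ (fderiv ℝ (fun z ↦ u z + N)) y v w =
      fderiv ℝ (fderiv ℝ (fun z ↦ u z + N)) y w v := by
    intro v w
    rw [fderiv_add_const_fun]
    exact (hu.contDiffAt (hU.mem_nhds hyU)).isSymmSndFDerivAt (by simp) v w
  have hηsymm : ∀ v w, fderiv ℝ (fderiv ℝ (eta (E := E) m)) y v w =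
      fderiv ℝ (fderiv ℝ (eta m)) y w v := fun v w ↦ by
    rw [fderiv_fderiv_eta_apply, fderiv_fderiv_eta_apply, real_inner_comm v w]; ring
  exact fderiv_fderiv_mul_symm hηw (differentiableAt_fderiv_eta m y)
    (differentiableAt_fderiv_negLog hφev hφ2) hηsymm
    (fderiv_fderiv_negLog_symm hφev hφ2 husymm) v w

/-- **The derivative of the barrier in `B₁`**, explicitly. [folklore] -/
theorem fderiv_barrier_eq (hU : IsOpen U) (hBU : closedBall (0 : E) 1 ⊆ U)
    (hu : ContDiffOn ℝ 2 u U) (hpos : ∀ y ∈ closedBall (0 : E) 1, 0 < u y + N) {y : E}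
    (hy : ‖y‖ < 1) :
    fderiv ℝ (barrier m u N) y =
      eta m y • ((-(u y + N)⁻¹) • fderiv ℝ u y) + (-Real.log (u y + N)) • (etaD1 m y • innerSL ℝ y) := by
  have hev := (eventually_differentiableAt_pos hU hBU hu hpos hu.continuousOn hy).self_of_nhds
  have hw := hasFDerivAt_negLog (hev.1.add_const N) hev.2
  rw [fderiv_add_const] at hw
  have h := (hasFDerivAt_eta m y).mul hw
  exact h.fderiv

/-- **Continuity of `Dv` in `B₁`.** [folklore] -/
theorem continuousOn_fderiv_barrier (hU : IsOpen U) (hBU : closedBall (0 : E) 1 ⊆ U)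
    (hu : ContDiffOn ℝ 2 u U) (hpos : ∀ y ∈ closedBall (0 : E) 1, 0 < u y + N) :
    ContinuousOn (fderiv ℝ (barrier m u N)) (ball (0 : E) 1) := by
  have hform : ∀ y ∈ ball (0 : E) 1, fderiv ℝ (barrier m u N) y =
      eta m y • ((-(u y + N)⁻¹) • fderiv ℝ u y) +
        (-Real.log (u y + N)) • (etaD1 m y • innerSL ℝ y) :=
    fun y hy ↦ fderiv_barrier_eq hU hBU hu hpos (mem_ball_zero_iff.1 hy)
  refine ContinuousOn.congr ?_ hform
  have hBU' : ball (0 : E) 1 ⊆ U := ball_subset_closedBall.trans hBU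
  have hcu : ContinuousOn u (ball (0 : E) 1) := hu.continuousOn.mono hBU'
  have hcDu : ContinuousOn (fderiv ℝ u) (ball (0 : E) 1) :=
    (hu.continuousOn_fderiv_of_isOpen hU (by norm_num)).mono hBU'
  have hne : ∀ y ∈ ball (0 : E) 1, u y + N ≠ 0 :=
    fun y hy ↦ (hpos y (ball_subset_closedBall hy)).ne'
  have hcη : ContinuousOn (eta (E := E) m) (ball 0 1) := (continuous_eta m).continuousOn
  have hcηD : ContinuousOn (etaD1 (E := E) m) (ball 0 1) := by
    unfold etaD1; fun_prop
  have hinner : ContinuousOn (fun y : E ↦ innerSL ℝ y) (ball 0 1) :=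
    (innerSL ℝ).continuous.continuousOn
  refine (hcη.smul (((hcu.add continuousOn_const).inv₀ hne).neg.smul hcDu)).add
    (((hcu.add continuousOn_const).log hne).neg.smul (hcηD.smul hinner))

/-- **Continuity of `∇v` in `B₁`.** [folklore] -/
theorem continuousOn_gradient_barrier [CompleteSpace E] (hU : IsOpen U)
    (hBU : closedBall (0 : E) 1 ⊆ U) (hu : ContDiffOn ℝ 2 u U)
    (hpos : ∀ y ∈ closedBall (0 : E) 1, 0 < u y + N) :
    ContinuousOn (gradient (barrier m u N)) (ball (0 : E) 1) := by
  have hg : gradient (barrier m u N) = fun y ↦ (toDual ℝ E).symm (fderiv ℝ (barrier m u N) y) := by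
    funext y; rfl
  rw [hg]
  exact (toDual ℝ E).symm.continuous.comp_continuousOn (continuousOn_fderiv_barrier hU hBU hu hpos)

omit [InnerProductSpace ℝ E] in
/-- **The barrier vanishes on the unit sphere.** [folklore] -/
theorem barrier_eq_zero_of_norm_eq_one {y : E} (hy : ‖y‖ = 1) : barrier m u N y = 0 := by
  rw [barrier, eta_eq_zero hy, zero_mul]

end Regularity

end Literature.Analysis.PDE.KrylovSafonov

end
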